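import Summits.BirchSwinnertonDyer.BirchSwinnertonDyer.Theorems.ClassRecordThreeEulerHalvesAtThreeEichlerShimuraLevelCountC
import Summits.BirchSwinnertonDyer.BirchSwinnertonDyer.Theorems.ClassRecordThreeEulerHalvesAtThreeEichlerShimuraLevelResidue
import Literature.NumberTheory.Automorphic.CuspFormRePeriodInjectiveArithmetic
import HarnessLib

/-!
# Eichler–Shimura surjectivity in weight two for `Γ₁(N)`, `N ≥ 4`: every real parabolic cocycle of
# `Γ₁(N)` is the real period cochain `γ ↦ Re ∫_{z₀}^{γ z₀} F` of a cusp form `F ∈ S₂(Γ₁(N))`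

Helper file (route `ClassRecordThree`, crux `EulerHalvesAtThree`, residue (ESᶜ-surj-Γ(M)) of the
Cartan-cover line). Assembly of

* the Shapiro count `6 dim_ℝ H¹_P(±Γ₁(N), ℝ) + 6ε_∞ ≤ 12 + μ₁` (`…EichlerShimuraLevelCountC`, with
  `ε₂(±Γ₁(N)) = ε₃(±Γ₁(N)) = 0`, `ModularFormsGamma1RankInput`),
* the weight-two dimension bound `μ₁ + 12 ≤ 12 dim_ℂ S₂(Γ₁(N)) + 6ε_∞` (`…EichlerShimuraLevelResidue`),
* the restriction `H¹_P(Γ₁(N), ℝ)_{GL} ↪ H¹_P(±Γ₁(N), ℝ)` along the retraction `±Γ₁(N) → Γ₁(N)`,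
  `g ↦ sign(g) g` (`retractGamma1`; `-1 ∉ Γ₁(N)` for `N ≥ 3`), and
* the injectivity of the real period map (`CuspForm.eq_zero_of_forall_rePeriod_eq_zero_of_isArithmetic`,
  Shimura Thm. 8.4, injectivity half, in the tree),

into **`dim_ℝ H¹_P(Γ₁(N), ℝ) ≤ 2 dim_ℂ S₂(Γ₁(N)) = dim_ℝ S₂(Γ₁(N))`**, whence the injective `ℝ`-linear
Eichler–Shimura map `F ↦ (γ ↦ Re ∫_{z₀}^{γ z₀} F)` is onto (`esMap_gamma1_surjective`,
`rePeriod_surjective_gamma1`): Shimura's Thm. 8.4 (surjectivity half, `n = 0`) for `Γ = Γ₁(N)`,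
`N ≥ 4`. Here `H¹_P(G, ℝ)_{GL}` (`parabolicHoms G`) is the space of additive `u : G → ℝ` vanishing on
the parabolic elements of the subgroup `G ≤ GL(2, ℝ)` — the exact shape quantified over in the named
fact `eichlerShimura_weightTwo_rePeriod_surjective_Gamma`. All proved; no named facts.

## References

* G. Shimura, *Introduction to the arithmetic theory of automorphic functions* (1971), §8.2,
  Thm. 8.4, (8.2.24), Prop. 8.3.
* F. Diamond, J. Shurman, *A first course in modular forms*, GTM 228 (2005), Thm. 3.5.1, Fig. 3.4.
-/

noncomputable section

open scoped MatrixGroups ModularForm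

open CongruenceSubgroup Matrix.SpecialLinearGroup ModularGroup UpperHalfPlane

set_option linter.dupNamespace false

namespace Summit.BirchSwinnertonDyer.BirchSwinnertonDyer.Theorems.EichlerShimuraLevel

open _root_.Module _root_.LinearMap
open Literature.NumberTheory.EllipticCurves.ModularForms Literature.NumberTheory.Automorphic
open scoped Classical

/-! ### Integral versus real parabolicity under `SL(2, ℤ) → GL(2, ℝ)` -/

/-- A `2 × 2` matrix is scalar iff its off-diagonal entries vanish and its diagonal entries agree.
[folklore] -/
theorem mem_range_scalar_fin_two_iff {R : Type*} [CommRing R] (M : Matrix (Fin 2) (Fin 2) R) :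
    M ∈ Set.range (Matrix.scalar (Fin 2)) ↔ M 0 1 = 0 ∧ M 1 0 = 0 ∧ M 0 0 = M 1 1 := by
  constructor
  · rintro ⟨a, rfl⟩
    simp [Matrix.scalar_apply]
  · rintro ⟨h01, h10, h00⟩
    refine ⟨M 0 0, ?_⟩
    ext i j
    fin_cases i <;> fin_cases j <;> simp [Matrix.scalar_apply, h01, h10, h00]

/-- **An integral parabolic matrix is parabolic over `ℝ`.** [folklore] -/
theorem isParabolic_map_intCast {m : Matrix (Fin 2) (Fin 2) ℤ} (h : m.IsParabolic) :
    (m.map (Int.cast : ℤ → ℝ)).IsParabolic := by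
  obtain ⟨hs, hd⟩ := h
  refine ⟨?_, ?_⟩
  · rw [mem_range_scalar_fin_two_iff] at hs ⊢
    simp only [Matrix.map_apply]
    exact_mod_cast hs
  · rw [Matrix.discr_fin_two, Matrix.trace_fin_two, Matrix.det_fin_two] at hd ⊢
    simp only [Matrix.map_apply]
    exact_mod_cast hd

/-- The real matrix of `γ ∈ SL(2, ℤ)` in `GL(2, ℝ)` is the entrywise cast. [folklore] -/
theorem val_mapGL_eq_map (γ : SL(2, ℤ)) :
    ((Matrix.SpecialLinearGroup.mapGL ℝ γ : GL (Fin 2) ℝ) : Matrix (Fin 2) (Fin 2) ℝ) =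
      (γ : Matrix (Fin 2) (Fin 2) ℤ).map (Int.cast : ℤ → ℝ) := by
  ext i j
  simp

/-- **The image in `GL(2, ℝ)` of an integral parabolic `γ ∈ SL(2, ℤ)` is parabolic.** [folklore] -/
theorem isParabolic_mapGL_of_isParabolic {γ : SL(2, ℤ)}
    (h : (γ : Matrix (Fin 2) (Fin 2) ℤ).IsParabolic) :
    Matrix.GeneralLinearGroup.IsParabolic (Matrix.SpecialLinearGroup.mapGL ℝ γ) := by
  change ((Matrix.SpecialLinearGroup.mapGL ℝ γ : GL (Fin 2) ℝ) : Matrix (Fin 2) (Fin 2) ℝ).IsParabolic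
  rw [val_mapGL_eq_map]
  exact isParabolic_map_intCast h

/-! ### The retraction `±Γ₁(N) → Γ₁(N)`, `g ↦ sign(g) g` (`N ≥ 3`) -/

section Retract

variable (N : ℕ)

/-- **The retraction `±Γ₁(N) → Γ₁(N)`**, `g ↦ g` on `Γ₁(N)` and `g ↦ -g` on `-Γ₁(N)` (a group
homomorphism with kernel `{±1}`, as `-1` is central and `-1 ∉ Γ₁(N)` for `N ≥ 3`). [folklore] -/
def retractGamma1 (hN : 3 ≤ N) : Gamma1pm N →* Gamma1 N where
  toFun g := if h : (g : SL(2, ℤ)) ∈ Gamma1 N then ⟨g, h⟩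
    else ⟨-g, (mem_gamma1pm.mp g.2).resolve_left h⟩
  map_one' := by
    have h1 : ((1 : Gamma1pm N) : SL(2, ℤ)) ∈ Gamma1 N := one_mem _
    rw [dif_pos h1]
    rfl
  map_mul' := by
    rintro ⟨a, ha⟩ ⟨b, hb⟩
    apply Subtype.ext
    simp only [Subgroup.coe_mul]
    rcases ha with ha | ha <;> rcases hb with hb | hb
    · rw [dif_pos (mul_mem ha hb), dif_pos ha, dif_pos hb]
    · have hab : a * b ∉ Gamma1 N := fun h ↦ not_mem_gamma1_of_neg_mem N hN hb
        (by simpa using mul_mem (inv_mem ha) h)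
      rw [dif_neg hab, dif_pos ha, dif_neg (not_mem_gamma1_of_neg_mem N hN hb)]
      simp
    · have hab : a * b ∉ Gamma1 N := fun h ↦ not_mem_gamma1_of_neg_mem N hN ha
        (by simpa using mul_mem h (inv_mem hb))
      rw [dif_neg hab, dif_neg (not_mem_gamma1_of_neg_mem N hN ha), dif_pos hb]
      simp
    · have hab : a * b ∈ Gamma1 N := by
        rw [show a * b = -a * -b by simp]
        exact mul_mem ha hb
      rw [dif_pos hab, dif_neg (not_mem_gamma1_of_neg_mem N hN ha),
        dif_neg (not_mem_gamma1_of_neg_mem N hN hb)]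
      simp

/-- On `Γ₁(N)` the retraction is the identity. [folklore] -/
theorem coe_retractGamma1_of_mem (hN : 3 ≤ N) {g : Gamma1pm N} (h : (g : SL(2, ℤ)) ∈ Gamma1 N) :
    ((retractGamma1 N hN g : Gamma1 N) : SL(2, ℤ)) = g := by
  have h1 : retractGamma1 N hN g = ⟨g, h⟩ := by
    simp only [retractGamma1, MonoidHom.coe_mk, OneHom.coe_mk]
    rw [dif_pos h]
  rw [h1]

/-- On `-Γ₁(N)` the retraction is `g ↦ -g`. [folklore] -/
theorem coe_retractGamma1_of_not_mem (hN : 3 ≤ N) {g : Gamma1pm N}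
    (h : (g : SL(2, ℤ)) ∉ Gamma1 N) : ((retractGamma1 N hN g : Gamma1 N) : SL(2, ℤ)) = -g := by
  have h1 : retractGamma1 N hN g = ⟨-g, (mem_gamma1pm.mp g.2).resolve_left h⟩ := by
    simp only [retractGamma1, MonoidHom.coe_mk, OneHom.coe_mk]
    rw [dif_neg h]
  rw [h1]

/-- The retraction preserves parabolicity (`±g` are parabolic together). [folklore] -/
theorem isParabolic_retractGamma1_iff (hN : 3 ≤ N) (g : Gamma1pm N) :
    (((retractGamma1 N hN g : Gamma1 N) : SL(2, ℤ)) : Matrix (Fin 2) (Fin 2) ℤ).IsParabolic ↔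
      ((g : SL(2, ℤ)) : Matrix (Fin 2) (Fin 2) ℤ).IsParabolic := by
  by_cases h : (g : SL(2, ℤ)) ∈ Gamma1 N
  · rw [coe_retractGamma1_of_mem N hN h]
  · rw [coe_retractGamma1_of_not_mem N hN h, Matrix.SpecialLinearGroup.coe_neg,
      Matrix.isParabolic_neg_iff]

end Retract

/-! ### The target of Eichler–Shimura: additive `u : G → ℝ` killing parabolic elements -/

section ParabolicHoms

variable (G : Subgroup (GL (Fin 2) ℝ))

/-- **`H¹_P(G, ℝ)` for a subgroup `G ≤ GL(2, ℝ)`**: additive `u : G → ℝ` with `u(γ) = 0` for every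
parabolic `γ ∈ G` (Mathlib's `Matrix.GeneralLinearGroup.IsParabolic`) — the space quantified over
in `(ESᶜ-surj-Γ(M))`. [cite: ShimuraIATAF1971, §8.1 (8.1.1), (8.1.4); §8.2 p. 234] -/
def parabolicHoms : Submodule ℝ (G → ℝ) where
  carrier := {u | (∀ γ δ : G, u (γ * δ) = u γ + u δ) ∧
    ∀ γ : G, (γ : GL (Fin 2) ℝ).IsParabolic → u γ = 0}
  add_mem' := by
    rintro u v ⟨hu, hu'⟩ ⟨hv, hv'⟩
    refine ⟨fun γ δ ↦ ?_, fun γ hγ ↦ ?_⟩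
    · simp only [Pi.add_apply, hu, hv]; ring
    · simp [hu' γ hγ, hv' γ hγ]
  zero_mem' := ⟨fun _ _ ↦ by simp, fun _ _ ↦ rfl⟩
  smul_mem' := by
    rintro c u ⟨hu, hu'⟩
    refine ⟨fun γ δ ↦ ?_, fun γ hγ ↦ ?_⟩
    · simp only [Pi.smul_apply, hu, smul_eq_mul]; ring
    · simp [hu' γ hγ]

variable {G}

/-- Unfolding `parabolicHoms`. [folklore] -/
theorem mem_parabolicHoms_iff {u : G → ℝ} :
    u ∈ parabolicHoms G ↔ (∀ γ δ : G, u (γ * δ) = u γ + u δ) ∧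
      ∀ γ : G, (γ : GL (Fin 2) ℝ).IsParabolic → u γ = 0 :=
  Iff.rfl

end ParabolicHoms

/-! ### The real Eichler–Shimura map and "injective + dimension count ⇒ onto" -/

section ESMap

variable {G : Subgroup (GL (Fin 2) ℝ)} [G.HasDetOne]

variable (G) in
/-- **The real Eichler–Shimura map** `φ_{z₀} : S₂(G) → H¹_P(G, ℝ)`, `F ↦ (γ ↦ Re ∫_{z₀}^{γ z₀} F)`,
`ℝ`-linear (`CuspForm.rePeriod_add/smul/mul/eq_zero_of_isParabolic`).
[cite: ShimuraIATAF1971, Thm. 8.4, (8.2.19)–(8.2.20)] -/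
def esMap (z₀ : ℍ) : CuspForm G 2 →ₗ[ℝ] parabolicHoms G where
  toFun F := ⟨fun γ ↦ CuspForm.rePeriod F z₀ γ, fun γ δ ↦ CuspForm.rePeriod_mul F z₀ γ δ,
    fun γ hγ ↦ CuspForm.rePeriod_eq_zero_of_isParabolic F z₀ hγ⟩
  map_add' F F' := by
    apply Subtype.ext
    funext γ
    exact CuspForm.rePeriod_add F F' z₀ γ
  map_smul' c F := by
    apply Subtype.ext
    funext γ
    exact CuspForm.rePeriod_smul c F z₀ γ

/-- Unfolding `esMap`. [folklore] -/
@[simp] theorem esMap_apply (z₀ : ℍ) (F : CuspForm G 2) (γ : G) :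
    (esMap G z₀ F : G → ℝ) γ = CuspForm.rePeriod F z₀ γ := rfl

/-- **`φ_{z₀}` is injective** for arithmetic `G` (Shimura Thm. 8.4, injectivity half, in the tree as
`CuspForm.eq_zero_of_forall_rePeriod_eq_zero_of_isArithmetic`). [cite: ShimuraIATAF1971, Thm. 8.4] -/
theorem esMap_injective [G.IsArithmetic] (z₀ : ℍ) : Function.Injective (esMap G z₀) := by
  rw [injective_iff_map_eq_zero]
  intro F hF
  exact CuspForm.eq_zero_of_forall_rePeriod_eq_zero_of_isArithmetic z₀ F
    fun γ ↦ by rw [← esMap_apply z₀ F γ, hF]; rfl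

/-- `dim_ℝ S₂(G) = 2 dim_ℂ S₂(G)` (for Mathlib's real structure on `CuspForm G 2`). [folklore] -/
theorem finrank_real_cuspForm [FiniteDimensional ℂ (CuspForm G 2)] :
    finrank ℝ (CuspForm G 2) = 2 * finrank ℂ (CuspForm G 2) := by
  haveI : IsScalarTower ℝ ℂ (CuspForm G 2) :=
    ⟨fun c w F ↦ by ext z; simp [mul_assoc]⟩
  rw [← Module.finrank_mul_finrank ℝ ℂ (CuspForm G 2), Complex.finrank_real_complex]

/-- `S₂(G)` is finite-dimensional over `ℝ` when it is over `ℂ`. [folklore] -/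
theorem finiteDimensional_real_cuspForm [FiniteDimensional ℂ (CuspForm G 2)] :
    FiniteDimensional ℝ (CuspForm G 2) := by
  haveI : IsScalarTower ℝ ℂ (CuspForm G 2) :=
    ⟨fun c w F ↦ by ext z; simp [mul_assoc]⟩
  exact Module.Finite.trans ℂ (CuspForm G 2)

/-- **Injective + `dim_ℝ H¹_P ≤ 2 dim_ℂ S₂` ⇒ `φ_{z₀}` is onto.** [cite: ShimuraIATAF1971, Thm. 8.4 (proof: dimension count (8.2.24))] -/
theorem esMap_surjective_of_finrank_le [G.IsArithmetic] [FiniteDimensional ℂ (CuspForm G 2)]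
    [FiniteDimensional ℝ (parabolicHoms G)] (z₀ : ℍ)
    (h : finrank ℝ (parabolicHoms G) ≤ 2 * finrank ℂ (CuspForm G 2)) :
    Function.Surjective (esMap G z₀) := by
  haveI : FiniteDimensional ℝ (CuspForm G 2) := finiteDimensional_real_cuspForm
  have hrk := LinearMap.finrank_range_add_finrank_ker (esMap G z₀)
  rw [LinearMap.ker_eq_bot.mpr (esMap_injective z₀), finrank_bot, add_zero,
    finrank_real_cuspForm] at hrk
  have hle := Submodule.finrank_le (LinearMap.range (esMap G z₀))
  have htop : LinearMap.range (esMap G z₀) = ⊤ := Submodule.eq_top_of_finrank_eq (by omega)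
  exact LinearMap.range_eq_top.mp htop

end ESMap

/-! ### `Γ₁(N)`: `dim_ℝ H¹_P(Γ₁(N), ℝ) ≤ 2 dim_ℂ S₂(Γ₁(N))` and surjectivity -/

section Gamma1

variable (N : ℕ)

/-- **Restriction along the retraction**: `u ↦ (g ↦ u(ι(sign(g) g)))` from `H¹_P(Γ₁(N), ℝ)_{GL}` to
`H¹_P(±Γ₁(N), ℝ)` (`ι : Γ₁(N) → GL(2, ℝ)`), `N ≥ 3`. [folklore] -/
def extendPM (hN : 3 ≤ N) :
    parabolicHoms ((Gamma1 N : Subgroup SL(2, ℤ)) : Subgroup (GL (Fin 2) ℝ)) →ₗ[ℝ]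
      parabolicCocycles (Gamma1pm N) where
  toFun u := ⟨fun g ↦ (u : _ → ℝ)
      ((Matrix.SpecialLinearGroup.mapGL ℝ).subgroupMap (Gamma1 N) (retractGamma1 N hN g)), by
    refine ⟨fun g h ↦ ?_, fun g hg ↦ ?_⟩
    · simp only [map_mul]
      exact (mem_parabolicHoms_iff.mp u.2).1 _ _
    · apply (mem_parabolicHoms_iff.mp u.2).2
      rw [MonoidHom.subgroupMap_apply_coe]
      exact isParabolic_mapGL_of_isParabolic ((isParabolic_retractGamma1_iff N hN g).mpr hg)⟩
  map_add' u v := by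
    apply Subtype.ext
    funext g
    rfl
  map_smul' c u := by
    apply Subtype.ext
    funext g
    rfl

/-- Unfolding `extendPM`. [folklore] -/
theorem extendPM_apply (hN : 3 ≤ N)
    (u : parabolicHoms ((Gamma1 N : Subgroup SL(2, ℤ)) : Subgroup (GL (Fin 2) ℝ)))
    (g : Gamma1pm N) :
    (extendPM N hN u : Gamma1pm N → ℝ) g =
      (u : _ → ℝ) ((Matrix.SpecialLinearGroup.mapGL ℝ).subgroupMap (Gamma1 N)
        (retractGamma1 N hN g)) := rfl

/-- The restriction along the retraction is injective (`Γ₁(N) ≤ ±Γ₁(N)` and the retraction is the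
identity there). [folklore] -/
theorem extendPM_injective (hN : 3 ≤ N) : Function.Injective (extendPM N hN) := by
  rw [injective_iff_map_eq_zero]
  intro u hu
  apply Subtype.ext
  funext γ
  obtain ⟨g, hg, hgγ⟩ := Subgroup.mem_map.mp γ.2
  have h1 : retractGamma1 N hN ⟨g, gamma1_le_gamma1pm N hg⟩ = ⟨g, hg⟩ :=
    Subtype.ext (coe_retractGamma1_of_mem N hN hg)
  have h2 : (Matrix.SpecialLinearGroup.mapGL ℝ).subgroupMap (Gamma1 N) ⟨g, hg⟩ = γ :=
    Subtype.ext hgγ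
  have h := congr_fun (congrArg Subtype.val hu) ⟨g, gamma1_le_gamma1pm N hg⟩
  rw [extendPM_apply, h1, h2] at h
  exact h

/-- `H¹_P(Γ₁(N), ℝ)_{GL}` is finite-dimensional (`N ≥ 3`). [folklore] -/
theorem finiteDimensional_parabolicHoms_gamma1 [NeZero N] (hN : 3 ≤ N) :
    FiniteDimensional ℝ
      (parabolicHoms ((Gamma1 N : Subgroup SL(2, ℤ)) : Subgroup (GL (Fin 2) ℝ))) := by
  haveI := finiteDimensional_parabolicCocycles (Gamma1pm N)
  exact Module.Finite.of_injective (extendPM N hN) (extendPM_injective N hN)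

/-- **`dim_ℝ H¹_P(Γ₁(N), ℝ) ≤ 2 dim_ℂ S₂(Γ₁(N))` for `N ≥ 4`**: the Shapiro count
`6h(±Γ₁(N)) + 6ε_∞ ≤ 12 + μ₁` (`ε₂ = ε₃ = 0`), the weight-two bound `μ₁ + 12 ≤ 12 dim S₂ + 6ε_∞`,
and `h(Γ₁(N)) ≤ h(±Γ₁(N))`. [cite: ShimuraIATAF1971, (8.2.24) with Prop. 8.3 (n = 0), Thm. 2.23] -/
theorem finrank_parabolicHoms_gamma1_le [NeZero N] (hN : 4 ≤ N) :
    finrank ℝ (parabolicHoms ((Gamma1 N : Subgroup SL(2, ℤ)) : Subgroup (GL (Fin 2) ℝ))) ≤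
      2 * finrank ℂ (CuspForm (Gamma1 N) 2) := by
  haveI := finiteDimensional_parabolicCocycles (Gamma1pm N)
  have h1 := LinearMap.finrank_le_finrank_of_injective (extendPM_injective N (by omega))
  have h2 := six_mul_finrank_parabolicCocycles_le (Γ := Gamma1pm N) (neg_one_mem_gamma1pm N)
  rw [nu₂Level_gamma1pm N (by omega), nu₃Level_gamma1pm N hN] at h2
  have h3 := index_gamma1pm_add_twelve_le N hN
  omega

/-- **Eichler–Shimura surjectivity for `Γ₁(N)`, `N ≥ 4`**: the real period map
`φ_{z₀} : S₂(Γ₁(N)) → H¹_P(Γ₁(N), ℝ)` is onto. [cite: ShimuraIATAF1971, Thm. 8.4] -/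
theorem esMap_gamma1_surjective [NeZero N] (hN : 4 ≤ N) (z₀ : ℍ) :
    Function.Surjective (esMap ((Gamma1 N : Subgroup SL(2, ℤ)) : Subgroup (GL (Fin 2) ℝ)) z₀) := by
  haveI : FiniteDimensional ℂ (CuspForm (Gamma1 N) 2) := finiteDimensional_cuspForm_gamma1_two N
  haveI := finiteDimensional_parabolicHoms_gamma1 N (by omega : 3 ≤ N)
  exact esMap_surjective_of_finrank_le z₀ (finrank_parabolicHoms_gamma1_le N hN)

/-- **(ESᶜ-surj) for `Γ₁(N)`, `N ≥ 4`, in the shape of the named fact**: every additive real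
`u` on `Γ₁(N) ≤ GL(2, ℝ)` killing the parabolic elements is `γ ↦ Re ∫_{z₀}^{γ z₀} F` for some
`F ∈ S₂(Γ₁(N))`. [cite: ShimuraIATAF1971, Thm. 8.4] -/
theorem rePeriod_surjective_gamma1 [NeZero N] (hN : 4 ≤ N) (z₀ : ℍ)
    (u : ↥((Gamma1 N : Subgroup SL(2, ℤ)) : Subgroup (GL (Fin 2) ℝ)) → ℝ)
    (hadd : ∀ γ δ, u (γ * δ) = u γ + u δ)
    (hpar : ∀ γ : ↥((Gamma1 N : Subgroup SL(2, ℤ)) : Subgroup (GL (Fin 2) ℝ)),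
      (γ : GL (Fin 2) ℝ).IsParabolic → u γ = 0) :
    ∃ F : CuspForm (Gamma1 N) 2, ∀ γ, CuspForm.rePeriod F z₀ γ = u γ := by
  obtain ⟨F, hF⟩ := esMap_gamma1_surjective N hN z₀ ⟨u, hadd, hpar⟩
  exact ⟨F, fun γ ↦ by rw [← esMap_apply z₀ F γ, hF]⟩

end Gamma1

end Summit.BirchSwinnertonDyer.BirchSwinnertonDyer.Theorems.EichlerShimuraLevel

end
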